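import Summits.CriticalPhenomena.PercolationContinuityZ3.Theorems.PercNearOneGluingNoHeavyPcintKernNFZ6S7Check1
import Summits.CriticalPhenomena.PercolationContinuityZ3.Theorems.PercNearOneGluingNoHeavyPcintKernNFZ6S7Check2
import HarnessLib

/-!
# PCINT lane: `p_c^site(ℤ⁶) ≥ 0.1002` (kernel-checked B2r window certificate on normal forms, memory 7 (6-step windows; 1539 first-use normal forms of 2985984 codes); printed lower bound = the bond one).

Cell `prim-pcint`, seat `prim-pcint-2` (gen 2); memo `run/shared/lean/prim/pcint/INTERVAL-PLAN.md` §15.  Does NOT build on p205010.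
Assembles the kernel-checked row blocks (`…KernNFZ6S7Check1..2`), closes the enumeration (`WinK.all_nfCodes_of_nfCodesIn`,
`WinK.allRange_nfOKS_of_nfCodes`) and applies `WinK.le_siteCriticalProb_of_checkSK` (`…PcintWinKernelSymCert`).
No external certificate, no `native_decide`; axioms standard.
-/

namespace Summit.CriticalPhenomena.PercolationContinuityZ3.Theorems.Pcint

open Literature.Probability.Percolation Literature.Probability.LatticeModels NFZ6S7

/-- All Collatz–Wielandt rows on the normal forms of the `2985984` window codes check. [folklore] -/
theorem NFZ6S7.chkAll : (WinK.nfCodes 6 6).all (WinK.rowOKSK 6 5 1002 9905 99999 tbl 70008) = true :=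
  WinK.all_nfCodes_of_nfCodesIn (hi := 2985984) (WinK.all_of_allB (fuel := 20) (by decide +kernel)) (WinK.all_nfCodesIn_append chkFile_1 chkFile_2)

/-- **`p_c^site(ℤ⁶) ≥ 0.1002`** (kernel-checked B2r window certificate on normal forms, memory 7 (6-step windows; 1539 first-use normal forms of 2985984 codes); printed lower bound = the bond one). [folklore] -/
theorem siteCriticalProb_Z6_ge_01002 : (0.1002 : ℝ) ≤ siteCriticalProb (zdGraph 6) 0 := by
  have h := WinK.le_siteCriticalProb_of_checkSK (d := 6) (m := 5) (pn := 1002) (Q := 9905) (lamN := 99999)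
      (tbl := tbl) (dflt := 70008) (vlo := 70008) (vhi := 100000) (by norm_num) (by norm_num) (by norm_num) (by norm_num)
      (by norm_num) tbl_bounds (by norm_num) (by norm_num)
      (WinK.allRange_nfOKS_of_nfCodes chkAll)
  have e : ((1002 : ℕ) : ℝ) / 10 ^ 4 = 0.1002 := by norm_num
  rw [e] at h
  exact h

end Summit.CriticalPhenomena.PercolationContinuityZ3.Theorems.Pcint
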